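import Literature.NumberTheory.Sieve.MontgomeryVaughan1975Section8Assembly
import HarnessLib

/-!
# Montgomery–Vaughan (1975), §§6–7: the error terms `W` — the formulae (6.17), (6.1͂7) and the
bounds (7.1), (7.͂1) as separate named facts

H. L. Montgomery, R. C. Vaughan, *The exceptional set in Goldbach's problem*, Acta Arith. 27
(1975) 353–370 [MontgomeryVaughanActa1975], pp. 361–366 (read from the journal scan). The tree's
named fact `Literature.NumberTheory.Sieve.MontgomeryVaughan1975.majorArc_formulae` records (6.17),
(6.1͂7) with (7.1), (7.͂1) already inserted. This file separates the two layers, exactly as printed: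

* the objects of §6: `S(χ, η) = ∑_{P<p≤X} (log p) χ(p) e(pη)` (2.3) (`charExpSum`), the remainders
  `W(χ, η)` of p. 361 — `S(χ₀,η) = T(η) + W(χ₀,η)`, `S(χ̃χ₀,η) = T̃(η) + W(χ̃χ₀,η)`, `S(χ,η) = W(χ,η)`
  otherwise (`errSum` when the exceptional character does not occur, `errSumExc` when it does),
  `W(χ) = (∫_{−1/rQ}^{1/rQ} |W(χ,η)|² dη)^{1/2}` (6.5) (`errNorm`) and `W = ∑_{q≤P} ∑*_χ W(χ)` (6.9)
  (`errTotal`, `errTotalExc`);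
* NAMED FACT `section6_formulae` — **(6.17)** `R₁(n) = 𝔖(n)n + O(X^{1+δ}P⁻¹) + O(nφ(n)⁻¹(WX^{1/2} + W²))`
  (`n ≤ X`) and **(6.1͂7)** `R₁(n) = 𝔖(n)n + 𝔖̃(n)Ĩ(n) + O(χ̃(n)²r̃nX/(φ(r̃)²φ(n))) + O(X^{1+δ}P⁻¹(n,r̃))
  + O(nφ(n)⁻¹(X^{1/2}W + W²))`, the output of §6 (pure identities and the estimates (6.6)–(6.20) from
  Lemmas 5.1–5.5, which are PROVED in `MontgomeryVaughan1975GaussSums.lean`), stated exactly under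
  the paper's hypotheses: (6.17) with `W` DEFINED as on p. 361 (no exceptional term subtracted), and
  (6.1͂7) for THE exceptional data of Lemma 4.1 (`IsExceptionalZero c₁ P r̃ χ̃ β̃`, `χ̃` quadratic);
  both facts are parametrised by the constant `c₁` of Lemma 4.1;
* NAMED FACT `section7_errorBounds` — **(7.1)** `W ≪ X^{1/2} exp(−c₆ log X/log P)` (no exceptional
  character) and **(7.͂1)** `W ≪ X^{1/2}(1 − β̃) exp(−c₆ log X/log P) log P` (exceptional character),
  the output of §7 = Lemma 4.2 (Gallagher's Lemma 1) + Lemma 4.3 (Gallagher's Theorem 7), under the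
  convention of Lemma 4.1 (`Lemma41At`, recorded as a conjunct; PROVED for small `c₁` in the tree,
  `lemma41At_of_lt`);
* PROVED: `majorArc_formulae_of_sections : section6_formulae c₁ → section7_errorBounds c₁ →
  majorArc_formulae` for any `c₁ > 0` (insert (7.1) into (6.17): `WX^{1/2} + W² ≪ X e^{−c₆/δ}`, and
  (7.͂1) into (6.1͂7): `X^{1/2}W + W² ≪ X (1−β̃)(log P) e^{−c₆/δ}` since `(1−β̃) log P ≤ c₁`).

After this file `Literature.NumberTheory.Sieve.goldbachExceptionalCount_isBigO_rpow` (parity.S15)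
rests on `section6_formulae c₁ ∧ section7_errorBounds c₁` for one `c₁ > 0` (the constant of
Lemma 4.1), through `goldbachExceptionalCount_isBigO_rpow_of_sections`.

## Design choices

* `W(χ)` (6.5) integrates over `|η| ≤ 1/(rQ)` with `r` the conductor; the sums (6.9) run over
  primitive `χ` mod `q`, so `r = q` and `errNorm Q q` is used.
* The identification "`χ` is the exceptional character" inside `∑*_χ` is `q = r̃ ∧ χ(n) = χ̃(n) ∀ n`
  (as in `gallagherTermExc`).
* Both facts take the constant `c₁` of Lemma 4.1 as a parameter, so that the exceptional data of
  (6.1͂7) and of (7.͂1) are the same; the printed content is `section6_formulae c₁ ∧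
  section7_errorBounds c₁` for that (small, absolute) `c₁`. As in `majorArc_formulae`, (6.1͂7) is
  recorded for even `n` with `𝔖̃(n) = excRatio χ̃ n · 𝔖(n)`, and under the printed hypothesis that
  `(r̃, χ̃, β̃)` is exceptional and `χ̃` quadratic (Lemma 4.1).
-/

noncomputable section

open Finset MeasureTheory Filter
open scoped FourierTransform

namespace Literature.NumberTheory.Sieve.MontgomeryVaughan1975

/-! ### §2, §6: `S(χ, η)` and the remainders `W` -/

/-- `S(χ, η) = ∑_{P<p≤X} (log p) χ(p) e(pη)` (Montgomery–Vaughan 1975, (2.3)).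
[cite: MontgomeryVaughanActa1975, §2 (2.3)] -/
def charExpSum (P X : ℝ) {q : ℕ} (χ : DirichletCharacter ℂ q) (η : ℝ) : ℂ :=
  ∑ p ∈ primeWindow P X, (Real.log p : ℂ) * χ (p : ZMod q) * (𝐞 (p * η) : ℂ)

/-- `W(χ, η)` when the exceptional character does not occur (Montgomery–Vaughan 1975, p. 361):
`S(χ₀, η) = T(η) + W(χ₀, η)` for the principal character (here: the primitive character mod `1`,
as `W(χ, η) = W(χ*, η)`), `S(χ, η) = W(χ, η)` otherwise. [cite: MontgomeryVaughanActa1975, §6 (6.2)] -/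
def errSum (P X : ℝ) {q : ℕ} (χ : DirichletCharacter ℂ q) (η : ℝ) : ℂ :=
  charExpSum P X χ η - if q = 1 then linSum P X η else 0

open scoped Classical in
/-- `W(χ, η)` in the presence of the exceptional character `χ̃` (mod `r̃`) with zero `β̃`
(Montgomery–Vaughan 1975, p. 361): in addition `S(χ̃χ₀, η) = T̃(η) + W(χ̃χ₀, η)`, i.e. the term of
`χ̃` itself (as a primitive character: `q = r̃` and `χ = χ̃` pointwise) is diminished by `T̃(η)`.
[cite: MontgomeryVaughanActa1975, §6 (6.2~)] -/
def errSumExc (P X : ℝ) {r : ℕ} (χe : DirichletCharacter ℂ r) (β : ℝ) {q : ℕ}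
    (χ : DirichletCharacter ℂ q) (η : ℝ) : ℂ :=
  errSum P X χ η -
    if q = r ∧ ∀ n : ℕ, χ (n : ZMod q) = χe (n : ZMod r) then excLinSum P X β η else 0

/-- `W(χ) = (∫_{−1/(rQ)}^{1/(rQ)} |W(χ, η)|² dη)^{1/2}` for a (primitive) character of conductor
`r = q` (Montgomery–Vaughan 1975, (6.5)), for any remainder function `F = W(χ, ·)`.
[cite: MontgomeryVaughanActa1975, §6 (6.5)] -/
def errNorm (Q : ℝ) (q : ℕ) (F : ℝ → ℂ) : ℝ :=
  (∫ η in (-(1 / (q * Q)))..(1 / (q * Q)), ‖F η‖ ^ 2) ^ (1 / 2 : ℝ)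

open scoped Classical in
/-- `W = ∑_{q≤P} ∑*_χ W(χ)` (Montgomery–Vaughan 1975, (6.9)), when the exceptional character does
not occur. [cite: MontgomeryVaughanActa1975, §6 (6.9)] -/
def errTotal (P Q X : ℝ) : ℝ :=
  ∑ q ∈ Icc 1 ⌊P⌋₊, ∑ χ : DirichletCharacter ℂ q with χ.IsPrimitive, errNorm Q q (errSum P X χ)

open scoped Classical in
/-- `W = ∑_{q≤P} ∑*_χ W(χ)` (Montgomery–Vaughan 1975, (6.9)) in the presence of the exceptional
character `χ̃` (mod `r̃`) with zero `β̃`. [cite: MontgomeryVaughanActa1975, §6 (6.9)] -/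
def errTotalExc (P Q X : ℝ) {r : ℕ} (χe : DirichletCharacter ℂ r) (β : ℝ) : ℝ :=
  ∑ q ∈ Icc 1 ⌊P⌋₊, ∑ χ : DirichletCharacter ℂ q with χ.IsPrimitive,
    errNorm Q q (errSumExc P X χe β χ)

/-! ### The two named facts -/

/-- NAMED FACT — **(6.17) and (6.1͂7) of Montgomery–Vaughan 1975** (p. 363: "Combining (6.4), (6.8),
and (6.15), we find altogether that (6.17) `R₁(n) = 𝔖(n)n + O(X^{1+δ}P⁻¹) + O(nφ(n)⁻¹(WX^{1/2} + W²))`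
for `n ≤ X`, provided that the exceptional term does not occur"; p. 365: "if the exceptional term
occurs then instead of (6.17) we have (6.1͂7) `R₁(n) = 𝔖(n)n + 𝔖̃(n)Ĩ(n) + O(χ̃(n)²r̃nX/(φ(r̃)²φ(n)))
+ O(X^{1+δ}P⁻¹(n,r̃)) + O(nφ(n)⁻¹(X^{1/2}W + W²))`, for `n ≤ X`"; `P = X^{6δ}`, `Q = X^{1−6δ}`,
`W` = (6.9) with (6.5)), for the constant `c₁` of Lemma 4.1 delineating the exceptional character at
level `P`. (a) is (6.17) with the remainders `W(χ, η) = S(χ, η) − [χ principal] T(η)` of p. 361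
(`errSum`): with `W` so DEFINED the proviso "the exceptional term does not occur" is only the
definition of `W`, so (a) carries no hypothesis. (b) is (6.1͂7) under the printed hypothesis: the
data `(r̃, χ̃, β̃)` are exceptional (`IsExceptionalZero c₁ P r̃ χ̃ β̃`) and `χ̃` is quadratic (Lemma
4.1), `W` = (6.9) with `W(χ̃χ₀, η) = S(χ̃χ₀, η) − T̃(η)` (`errSumExc`); it is recorded for even `n`,
with `𝔖̃(n) = excRatio χ̃ n · 𝔖(n)`, `χ̃(n)² = 𝟙_{(n,r̃)=1}`, `𝔖(n)` of (6.16) the tree's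
`goldbachSingularSeries n`. Not in Mathlib; the §6 computation over the PROVED §5
(`MontgomeryVaughan1975GaussSums.lean`). [cite: MontgomeryVaughanActa1975, §6 (6.17) and (6.17~)] -/
def section6_formulae (c₁ : ℝ) : Prop :=
  ∃ C : ℝ, 0 < C ∧ ∃ δ₀ : ℝ, 0 < δ₀ ∧ ∀ δ : ℝ, 0 < δ → δ ≤ δ₀ → ∃ X₀ : ℝ, ∀ X : ℝ, X₀ ≤ X →
    (∀ n : ℕ, 1 ≤ n → (n : ℝ) ≤ X →
      ‖majorArcIntegral (X ^ (6 * δ)) (X ^ (1 - 6 * δ)) X n -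
          ((goldbachSingularSeries n * n : ℝ) : ℂ)‖ ≤
        C * (X ^ (1 + δ) * (X ^ (6 * δ))⁻¹ +
          (n : ℝ) / (Nat.totient n : ℝ) *
            (errTotal (X ^ (6 * δ)) (X ^ (1 - 6 * δ)) X * X ^ (1 / 2 : ℝ) +
              errTotal (X ^ (6 * δ)) (X ^ (1 - 6 * δ)) X ^ 2))) ∧
    (∀ (r : ℕ) [NeZero r] (χ : DirichletCharacter ℂ r) (β : ℝ),
        IsExceptionalZero c₁ (X ^ (6 * δ)) r χ β → χ ^ 2 = 1 →
      ∀ n : ℕ, 1 ≤ n → (n : ℝ) ≤ X → Even n →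
        ‖majorArcIntegral (X ^ (6 * δ)) (X ^ (1 - 6 * δ)) X n -
            ((goldbachSingularSeries n *
                (n + excRatio χ n * excPairSum (X ^ (6 * δ)) X β n) : ℝ) : ℂ)‖ ≤
          C * ((if n.Coprime r then (r : ℝ) * n * X / ((Nat.totient r : ℝ) ^ 2 * Nat.totient n)
                else 0) +
            X ^ (1 + δ) * (X ^ (6 * δ))⁻¹ * Nat.gcd n r +
            (n : ℝ) / (Nat.totient n : ℝ) *
              (X ^ (1 / 2 : ℝ) * errTotalExc (X ^ (6 * δ)) (X ^ (1 - 6 * δ)) X χ β +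
                errTotalExc (X ^ (6 * δ)) (X ^ (1 - 6 * δ)) X χ β ^ 2)))

/-- NAMED FACT — **(7.1) and (7.͂1) of Montgomery–Vaughan 1975** (§7, p. 366: by Lemma 4.2,
`W(χ) ≪ X^{1/2} max_{x≤2X} max_{0<h≤X} (h + XP⁻¹)⁻¹ |∑#_{x−h}^{x} χ(p) log p|` "in the notation of
Lemma 4.3, an application of which gives (7.1) `W ≪ X^{1/2} exp(−c₆ log X/log P)` if there is no
exceptional term. If the exceptional term occurs then (7.͂1)
`W ≪ X^{1/2}(1 − β̃) exp(−c₆ log X/log P) log P`"), for `P = X^{6δ}`, `Q = X^{1−6δ}`, `0 < δ ≤ δ₀`,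
`X ≥ X₀(δ)` (so that `exp(log^{1/2} X) ≤ P ≤ X^{c₄}` in Lemma 4.3), the exceptional character being
delineated at level `P` by the constant `c₁` of Lemma 4.1 (the parameter), whose content (`Lemma41At`)
is recorded as a conjunct (PROVED for small `c₁`: `lemma41At_of_lt`); `log X/log P = (6δ)⁻¹` and
`exp(−c₆/(6δ))` is written `exp(−c₆/δ)`. The output of Lemmas 4.2 (`lemma42_gallagher`) and 4.3
(`lemma43_gallagher`); the printed content is `∃ c₁ > 0, section7_errorBounds c₁`. Not in Mathlib.
[cite: MontgomeryVaughanActa1975, §7 (7.1) and (7.1~)] -/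
def section7_errorBounds (c₁ : ℝ) : Prop :=
  ∃ c₆ : ℝ, 0 < c₆ ∧ ∃ C : ℝ, 0 < C ∧ ∃ δ₀ : ℝ, 0 < δ₀ ∧
    ∀ δ : ℝ, 0 < δ → δ ≤ δ₀ → ∃ X₀ : ℝ, ∀ X : ℝ, X₀ ≤ X →
      Lemma41At c₁ (X ^ (6 * δ)) ∧
      ((∀ (r : ℕ) [NeZero r] (χ : DirichletCharacter ℂ r) (β : ℝ),
            ¬ IsExceptionalZero c₁ (X ^ (6 * δ)) r χ β) →
        errTotal (X ^ (6 * δ)) (X ^ (1 - 6 * δ)) X ≤ C * X ^ (1 / 2 : ℝ) * Real.exp (-(c₆ / δ))) ∧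
      (∀ (r : ℕ) [NeZero r] (χ : DirichletCharacter ℂ r) (β : ℝ),
          IsExceptionalZero c₁ (X ^ (6 * δ)) r χ β →
        errTotalExc (X ^ (6 * δ)) (X ^ (1 - 6 * δ)) X χ β ≤
          C * X ^ (1 / 2 : ℝ) * ((1 - β) * Real.log (X ^ (6 * δ))) * Real.exp (-(c₆ / δ)))

/-! ### Proved: nonnegativity of the norms, and the insertion of §7 into §6 -/

/-- `W(χ) ≥ 0`. [folklore] -/
theorem errNorm_nonneg (Q : ℝ) (q : ℕ) (F : ℝ → ℂ) : 0 ≤ errNorm Q q F := by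
  unfold errNorm
  rcases le_or_gt 0 (∫ η in (-(1 / (q * Q)))..(1 / (q * Q)), ‖F η‖ ^ 2) with h | h
  · exact Real.rpow_nonneg h _
  · rw [Real.rpow_def_of_neg h]
    have : Real.cos (1 / 2 * Real.pi) = 0 := by
      rw [show 1 / 2 * Real.pi = Real.pi / 2 by ring, Real.cos_pi_div_two]
    rw [this, mul_zero]

open scoped Classical in
/-- `W ≥ 0` ((6.9) is a sum of nonnegative terms). [folklore] -/
theorem errTotal_nonneg (P Q X : ℝ) : 0 ≤ errTotal P Q X :=
  Finset.sum_nonneg fun _ _ => Finset.sum_nonneg fun _ _ => errNorm_nonneg _ _ _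

open scoped Classical in
/-- `W ≥ 0` in the exceptional case. [folklore] -/
theorem errTotalExc_nonneg (P Q X : ℝ) {r : ℕ} (χe : DirichletCharacter ℂ r) (β : ℝ) :
    0 ≤ errTotalExc P Q X χe β :=
  Finset.sum_nonneg fun _ _ => Finset.sum_nonneg fun _ _ => errNorm_nonneg _ _ _

/-- Insertion bookkeeping: `0 ≤ W ≤ K X^{1/2} u` with `0 ≤ u ≤ 1` gives `W X^{1/2} + W² ≤ (K + K²) X u`.
[folklore] -/
theorem insert_bound {W K X u : ℝ} (hW0 : 0 ≤ W) (hW : W ≤ K * X ^ (1 / 2 : ℝ) * u)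
    (hX : 0 ≤ X) (hu0 : 0 ≤ u) (hu1 : u ≤ 1) :
    W * X ^ (1 / 2 : ℝ) + W ^ 2 ≤ (K + K ^ 2) * X * u := by
  have hs : X ^ (1 / 2 : ℝ) * X ^ (1 / 2 : ℝ) = X := by
    rw [← Real.rpow_add_of_nonneg hX (by norm_num) (by norm_num)]; norm_num
  have hs0 : 0 ≤ X ^ (1 / 2 : ℝ) := Real.rpow_nonneg hX _
  have h1 : W * X ^ (1 / 2 : ℝ) ≤ K * X * u := by
    calc W * X ^ (1 / 2 : ℝ) ≤ (K * X ^ (1 / 2 : ℝ) * u) * X ^ (1 / 2 : ℝ) :=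
          mul_le_mul_of_nonneg_right hW hs0
      _ = K * (X ^ (1 / 2 : ℝ) * X ^ (1 / 2 : ℝ)) * u := by ring
      _ = K * X * u := by rw [hs]
  have h2 : W ^ 2 ≤ K ^ 2 * X * u := by
    calc W ^ 2 ≤ (K * X ^ (1 / 2 : ℝ) * u) ^ 2 := pow_le_pow_left₀ hW0 hW 2
      _ = K ^ 2 * (X ^ (1 / 2 : ℝ) * X ^ (1 / 2 : ℝ)) * (u * u) := by ring
      _ ≤ K ^ 2 * (X ^ (1 / 2 : ℝ) * X ^ (1 / 2 : ℝ)) * (u * 1) := by gcongr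
      _ = K ^ 2 * X * u := by rw [hs]; ring
  nlinarith

/-- Arithmetic of the insertion in case (i). [folklore] -/
theorem insert_i {A E t X u W C₆ K₀ K : ℝ} (h : A ≤ C₆ * (E + t * (W * X ^ (1 / 2 : ℝ) + W ^ 2)))
    (hins : W * X ^ (1 / 2 : ℝ) + W ^ 2 ≤ K₀ * X * u) (hK : K₀ ≤ 1 + K) (hC₆ : 0 ≤ C₆) (ht : 0 ≤ t)
    (hE : 0 ≤ E) (hX : 0 ≤ X) (hu : 0 ≤ u) (hK0 : 0 ≤ K) :
    A ≤ C₆ * (1 + K) * (E + t * X * u) := by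
  have h1 : t * (W * X ^ (1 / 2 : ℝ) + W ^ 2) ≤ t * ((1 + K) * (X * u)) := by
    apply mul_le_mul_of_nonneg_left _ ht
    calc W * X ^ (1 / 2 : ℝ) + W ^ 2 ≤ K₀ * X * u := hins
      _ = K₀ * (X * u) := by ring
      _ ≤ (1 + K) * (X * u) := mul_le_mul_of_nonneg_right hK (by positivity)
  have h2 : E ≤ (1 + K) * E := le_mul_of_one_le_left hE (by linarith)
  calc A ≤ C₆ * (E + t * (W * X ^ (1 / 2 : ℝ) + W ^ 2)) := h
    _ ≤ C₆ * ((1 + K) * E + t * ((1 + K) * (X * u))) := by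
        apply mul_le_mul_of_nonneg_left _ hC₆; linarith
    _ = C₆ * (1 + K) * (E + t * X * u) := by ring

/-- Arithmetic of the insertion in case (ii). [folklore] -/
theorem insert_ii {A E₁ E₂ t X L ε W C₆ K₀ K : ℝ}
    (h : A ≤ C₆ * (E₁ + E₂ + t * (X ^ (1 / 2 : ℝ) * W + W ^ 2)))
    (hins : X ^ (1 / 2 : ℝ) * W + W ^ 2 ≤ K₀ * X * L * ε) (hK : K₀ ≤ 1 + K) (hC₆ : 0 ≤ C₆)
    (ht : 0 ≤ t) (hE₁ : 0 ≤ E₁) (hE₂ : 0 ≤ E₂) (hX : 0 ≤ X) (hL : 0 ≤ L) (hε : 0 ≤ ε)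
    (hK0 : 0 ≤ K) : A ≤ C₆ * (1 + K) * (E₁ + E₂ + t * X * L * ε) := by
  have h1 : t * (X ^ (1 / 2 : ℝ) * W + W ^ 2) ≤ t * ((1 + K) * (X * L * ε)) := by
    apply mul_le_mul_of_nonneg_left _ ht
    calc X ^ (1 / 2 : ℝ) * W + W ^ 2 ≤ K₀ * X * L * ε := hins
      _ = K₀ * (X * L * ε) := by ring
      _ ≤ (1 + K) * (X * L * ε) := mul_le_mul_of_nonneg_right hK (by positivity)
  have h2 : E₁ + E₂ ≤ (1 + K) * (E₁ + E₂) := le_mul_of_one_le_left (by positivity) (by linarith)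
  calc A ≤ _ := h
    _ ≤ C₆ * ((1 + K) * (E₁ + E₂) + t * ((1 + K) * (X * L * ε))) := by
        apply mul_le_mul_of_nonneg_left _ hC₆; linarith
    _ = C₆ * (1 + K) * (E₁ + E₂ + t * X * L * ε) := by ring

/-- **(6.17), (6.1͂7) with (7.1), (7.͂1) inserted** (Montgomery–Vaughan 1975, §8, first lines of the
two cases on p. 367: "from (6.17) and (7.1) it follows that
`R₁(n) = 𝔖(n)n + O(nφ(n)⁻¹X exp(−c₇δ⁻¹))`"; "we appeal to (6.1͂7) and (7.͂1)"):
`section6_formulae c₁ → section7_errorBounds c₁ → majorArc_formulae` (same `c₁` of Lemma 4.1 in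
both). With `ε = e^{−c₆/δ} ≤ 1` and `L = (1 − β̃) log P ≤ c₁`: `WX^{1/2} + W² ≤ (C₇ + C₇²) X ε` and
`X^{1/2}W + W² ≤ (C₇ + C₇²c₁) X L ε`. [cite: MontgomeryVaughanActa1975, §8 (8.4)] -/
theorem majorArc_formulae_of_sections {c₁ : ℝ} (hc₁ : 0 < c₁) (h6 : section6_formulae c₁)
    (h7 : section7_errorBounds c₁) : majorArc_formulae := by
  obtain ⟨C₆, hC₆, δ₆, hδ₆, H6⟩ := h6
  obtain ⟨c₆, hc₆, C₇, hC₇, δ₇, hδ₇, H7⟩ := h7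
  set K : ℝ := C₇ + C₇ ^ 2 * (1 + c₁) with hK
  have hK0 : 0 ≤ K := by positivity
  refine ⟨c₁, hc₁, c₆, hc₆, C₆ * (1 + K), by positivity, min δ₆ δ₇, lt_min hδ₆ hδ₇,
    fun δ hδ hδle => ?_⟩
  obtain ⟨X₆, hX₆⟩ := H6 δ hδ (hδle.trans (min_le_left _ _))
  obtain ⟨X₇, hX₇⟩ := H7 δ hδ (hδle.trans (min_le_right _ _))
  -- threshold: `c₁ < log P` (so that an exceptional `β` is positive) and `X ≥ 1`
  have hev : ∀ᶠ X : ℝ in atTop, c₁ < Real.log (X ^ (6 * δ)) ∧ 1 ≤ X := by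
    have h1 := (Real.tendsto_log_atTop.comp (tendsto_rpow_atTop (by linarith : 0 < 6 * δ))).eventually_gt_atTop c₁
    filter_upwards [h1, eventually_ge_atTop (1 : ℝ)] with X hX hX1
    exact ⟨hX, hX1⟩
  obtain ⟨X₈, hX₈⟩ := Filter.eventually_atTop.mp hev
  refine ⟨max (max X₆ X₇) X₈, fun X hX => ?_⟩
  have hXX₆ : X₆ ≤ X := ((le_max_left _ _).trans (le_max_left _ _)).trans hX
  have hXX₇ : X₇ ≤ X := ((le_max_right _ _).trans (le_max_left _ _)).trans hX
  obtain ⟨hlogP, hX1⟩ := hX₈ X ((le_max_right _ _).trans hX)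
  have hX0 : 0 ≤ X := zero_le_one.trans hX1
  obtain ⟨h6a, h6b⟩ := hX₆ X hXX₆
  obtain ⟨h41, h7a, h7b⟩ := hX₇ X hXX₇
  set P : ℝ := X ^ (6 * δ) with hP
  set Q : ℝ := X ^ (1 - 6 * δ) with hQ
  set ε : ℝ := Real.exp (-(c₆ / δ)) with hε
  have hε0 : 0 ≤ ε := (Real.exp_pos _).le
  have hε1 : ε ≤ 1 := by rw [hε, Real.exp_le_one_iff]; exact neg_nonpos.mpr (div_nonneg hc₆.le hδ.le)
  have hlogP0 : 0 < Real.log P := lt_trans hc₁ hlogP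
  refine ⟨h41, fun hno n hn1 hnX => ?_, fun r _ χ β hEZ n hn1 hnX heven => ?_⟩
  · -- (i): insert (7.1) into (6.17)
    have hW := h7a hno
    have hW0 := errTotal_nonneg P Q X
    have hins := insert_bound hW0 hW hX0 hε0 hε1
    have ht : 0 ≤ (n : ℝ) / (Nat.totient n : ℝ) := by positivity
    have hE0 : 0 ≤ X ^ (1 + δ) * P⁻¹ := by
      have : 0 ≤ P := by rw [hP]; exact Real.rpow_nonneg hX0 _
      positivity
    have hK' : C₇ + C₇ ^ 2 ≤ 1 + K := by rw [hK]; nlinarith [sq_nonneg C₇]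
    exact insert_i (h6a n hn1 hnX) hins hK' hC₆.le ht hE0 hX0 hε0 hK0
  · -- (ii): insert (7.1~) into (6.17~)
    have hquad : χ ^ 2 = 1 := h41.1 r χ β hEZ
    have hW := h7b r χ β hEZ
    have hEZ' := hEZ
    obtain ⟨hprim, hne, hrP, hβlo, hβ1, _⟩ := hEZ'
    have hβ0 : 0 < β := by
      have : c₁ / Real.log P < 1 := (div_lt_one hlogP0).mpr hlogP
      linarith
    set L : ℝ := (1 - β) * Real.log P with hL
    have hL0 : 0 ≤ L := mul_nonneg (by linarith) hlogP0.le
    have hLc : L ≤ c₁ := by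
      have h1 : 1 - β ≤ c₁ / Real.log P := by linarith
      calc L = (1 - β) * Real.log P := rfl
        _ ≤ c₁ / Real.log P * Real.log P := mul_le_mul_of_nonneg_right h1 hlogP0.le
        _ = c₁ := div_mul_cancel₀ c₁ hlogP0.ne'
    set W := errTotalExc P Q X χ β with hWdef
    have hW0 : 0 ≤ W := errTotalExc_nonneg P Q X χ β
    -- `W ≤ (C₇ L) X^{1/2} ε`, hence `X^{1/2} W + W² ≤ (C₇ L + (C₇ L)²) X ε ≤ (C₇ + C₇² c₁) X L ε`
    have hW' : W ≤ (C₇ * L) * X ^ (1 / 2 : ℝ) * ε := by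
      calc W ≤ C₇ * X ^ (1 / 2 : ℝ) * L * ε := hW
        _ = (C₇ * L) * X ^ (1 / 2 : ℝ) * ε := by ring
    have hins := insert_bound hW0 hW' hX0 hε0 hε1
    have hins' : X ^ (1 / 2 : ℝ) * W + W ^ 2 ≤ (C₇ + C₇ ^ 2 * c₁) * X * L * ε := by
      have h1 : (C₇ * L + (C₇ * L) ^ 2) * X * ε ≤ (C₇ + C₇ ^ 2 * c₁) * X * L * ε := by
        have : (C₇ * L + (C₇ * L) ^ 2) ≤ (C₇ + C₇ ^ 2 * c₁) * L := by
          have : C₇ ^ 2 * L * L ≤ C₇ ^ 2 * c₁ * L := by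
            have := mul_le_mul_of_nonneg_left hLc (by positivity : 0 ≤ C₇ ^ 2 * L)
            linarith
          nlinarith
        calc (C₇ * L + (C₇ * L) ^ 2) * X * ε = (C₇ * L + (C₇ * L) ^ 2) * (X * ε) := by ring
          _ ≤ (C₇ + C₇ ^ 2 * c₁) * L * (X * ε) := mul_le_mul_of_nonneg_right this (by positivity)
          _ = _ := by ring
      calc X ^ (1 / 2 : ℝ) * W + W ^ 2 = W * X ^ (1 / 2 : ℝ) + W ^ 2 := by ring
        _ ≤ (C₇ * L + (C₇ * L) ^ 2) * X * ε := hins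
        _ ≤ _ := h1
    have ht : 0 ≤ (n : ℝ) / (Nat.totient n : ℝ) := by positivity
    have hE₁0 : 0 ≤ (if n.Coprime r then (r : ℝ) * n * X / ((Nat.totient r : ℝ) ^ 2 * Nat.totient n)
        else 0) := by split_ifs <;> positivity
    have hE₂0 : 0 ≤ X ^ (1 + δ) * P⁻¹ * (Nat.gcd n r : ℝ) := by
      have : 0 ≤ P := by rw [hP]; exact Real.rpow_nonneg hX0 _
      positivity
    have hK' : C₇ + C₇ ^ 2 * c₁ ≤ 1 + K := by rw [hK]; nlinarith [sq_nonneg C₇, hC₇.le]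
    have h6bn := h6b r χ β hEZ hquad n hn1 hnX heven
    exact insert_ii h6bn hins' hK' hC₆.le ht hE₁0 hE₂0 hX0 hL0 hε0 hK0

end Literature.NumberTheory.Sieve.MontgomeryVaughan1975

namespace Literature.NumberTheory.Sieve

open MontgomeryVaughan1975

/-- **Montgomery–Vaughan 1975, Theorem 1, from §6 and §7 separately** (parity.S15): for the constant
`c₁ > 0` of Lemma 4.1, `section6_formulae c₁ → section7_errorBounds c₁ → goldbachExceptionalCount_isBigO_rpow`.
[cite: MontgomeryVaughanActa1975, Theorem 1] -/
theorem goldbachExceptionalCount_isBigO_rpow_of_sections {c₁ : ℝ} (hc₁ : 0 < c₁)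
    (h6 : section6_formulae c₁) (h7 : section7_errorBounds c₁) :
    goldbachExceptionalCount_isBigO_rpow :=
  goldbachExceptionalCount_isBigO_rpow_of_formulae (majorArc_formulae_of_sections hc₁ h6 h7)

end Literature.NumberTheory.Sieve
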